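import Mathlib.Algebra.Order.Group.Abs
import Mathlib.Algebra.Order.Group.Multiset
import Mathlib.Algebra.Order.BigOperators.Group.Finset
import Mathlib.Tactic.Abel
import Mathlib.Data.Fintype.Card
import Mathlib.Data.Fintype.EquivFin
import Mathlib.Data.Fintype.Sum
import Mathlib.Logic.Equiv.Basic
import HarnessLib

/-!
# Weyl-group orbits of `Sp_{2n}` (and of `O_{2n}`, `GL_n`) inject into those of `GL_{2n}` under `x ↦ (x, −x)`
# (Kottwitz 1992, proof of Lemma 7.4, Cases A and C)

Topic `GroupTheory/Coxeter`, namespace `Literature.GroupTheory.Coxeter.WeylOrbitInjectivity` (lane `lit-hodgefound`, Track 2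
foundations; seat `lit-hodgefound-p11`, generation 33, row g33-#7).  THEOREMS ONLY (D-0026): no definition, no named fact,
no instance, no notation.

## The print, verbatim

R. E. Kottwitz, *Points on some Shimura varieties over finite fields*, J. Amer. Math. Soc. 5 (1992) [Kottwitz1992], §7,
Lemma 7.4 and its proof (held copy `paper:doi-10-2307-2152772`, PDF p0025 L5–L27): «Lemma 7.4. Let `x, y ∈ G(ℚ_p)`, and
assume that `K_H i(x) K_H = K_H i(y) K_H`. Then `KxK = KyK`.  First consider Cases A and C, so that `G` is connected. Let `S` be
a maximal `ℚ_p`-split torus in the quasi-split group `G` and `Ω_{ℚ_p}` be the relative Weyl group of `S`. Then the double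
cosets of `K` in `G(ℚ_p)` are in one-to-one correspondence with the orbits of `Ω_{ℚ_p}` on `X_*(S)`, and the analogous
statement holds for `H` as well. […] It is enough to prove that if two elements `x, y ∈ X := X_*(T) ⊗ ℝ` are such that
`i(x), i(y)` are in the same orbit of `Ω_H` in `X_H := X_*(T_H) ⊗ ℝ`, then `x, y` are in the same orbit of `Ω` in `X`. […]
our problem decomposes as a product of problems of the form `GL_n → GL_n × GL_n` (diagonal map) in Case A and of the form
`Sp_{2n} → GL_{2n}` in Case C. Thus Case A is trivial. In Case C note that every positive root for `Sp_{2n}` is the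
restriction of a positive root for `GL_{2n}`, so that the positive Weyl chamber for `Sp_{2n}` is contained in the positive
Weyl chamber for `GL_{2n}`. This gives what we want, since the closure of any Weyl chamber is a fundamental domain for the
action of the Weyl group.»  (Case D, `G = GO_{2n}` disconnected: «the groups `K/K⁰` and `Ω_{ℚ_p}/Ω⁰_{ℚ_p}` are equal, and
we see that the double cosets `K\\G(ℚ_p)/K` are in one-to-one correspondence with the orbits of `Ω_{ℚ_p}` on `X_*(S)`» —
`Ω_{ℚ_p}` is then again the full group of signed permutations.)

## What is formalised (the combinatorial statement, in coordinates)

For `Sp_{2n} ⊂ GL_{2n}` (and `O_{2n} ⊂ GL_{2n}`) with the diagonal tori, `X_*(T) = ℤⁿ`, `X_*(T_H) = ℤ²ⁿ`, `i(x) = (x, −x)`, the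
Weyl group `Ω` is the group of SIGNED PERMUTATIONS of the `n` coordinates and `Ω_H = S_{2n}` permutes the `2n` coordinates.
We work with coordinates in any linearly ordered additive commutative group `α` (`ℤ`, `ℝ = X_* ⊗ ℝ`, …) indexed by a finite
type `ι`:

* **`exists_perm_forall_eq_or_eq_neg`** — CASE C ∕ D: if the multisets `{y_i} + {−y_i}` and `{x_i} + {−x_i}` coincide
  (i.e. `i(y) ∈ S_{2n} · i(x)`), then `y_i = ± x_{π(i)}` for a permutation `π` (i.e. `y ∈ Ω · x`);
  `exists_perm_forall_eq_or_eq_neg_of_perm_sum` — the same with the hypothesis as a permutation `τ` of `ι ⊕ ι` carrying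
  `i(x) = Sum.elim x (−x)` to `i(y)`; `map_add_map_neg_eq_of_perm` — the (easy) converse, so the orbit map is injective
  exactly.
* `exists_perm_of_perm_prod` — CASE A («trivial»): for the diagonal `GL_n → GL_n × GL_n`, `x ↦ (x, x)`, if
  `(y, y) = (x ∘ π₁, x ∘ π₂)` then `y = x ∘ π₁`.
* **`exists_perm_forall_eq_or_eq_sub`** — the SIMILITUDE group `GSp_{2n} → GL_{2n}`, `i(x; z) = (x, z − x)` («modifying
  `x, y` by an element of the form `j(z)` […] we may assume that `x, y ∈ X_*(T ∩ G_1) ⊗ ℝ»): equal multisets force `z' = z`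
  and `y_i ∈ {x_{π(i)}, z − x_{π(i)}}`; proved over any linearly ordered group (doubling instead of halving).

Our proof of the Case C statement replaces the Weyl-chamber argument by the equivalent elementary one: `|·|` is constant on
`{a, −a}`, so the multiset of absolute values `{|y_i|}` is determined (after halving multiplicities) by `i(y)`; equal
multisets of absolute values are matched by a permutation `π` of the index set (fibrewise bijections,
`Equiv.ofFiberEquiv`), and `|y_i| = |x_{π i}|` means `y_i = ± x_{π i}`.  Not formalised here: the Cartan decomposition
`K\\G(ℚ_p)/K ≅ X_*(S)/Ω_{ℚ_p}` itself (for `GL_n` it is the tree's `NumberTheory/Automorphic/CartanDecompositionGLn`), hence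
not Lemma 7.4 as a statement about double cosets.

## References

* [Kottwitz1992] R. E. Kottwitz, *Points on some Shimura varieties over finite fields*, J. Amer. Math. Soc. 5 (1992)
  373–444, §7 Lemma 7.4 and its proof, p. 397.
-/

set_option autoImplicit false

namespace Literature.GroupTheory.Coxeter.WeylOrbitInjectivity

open Finset

variable {ι : Type*} [Fintype ι] {α : Type*}

/-! ## §1 Equal multisets of values are matched by a permutation of the indices; `(z, −z)` as one vector on `ι ⊕ ι` -/

/-- [folklore] two functions on a finite type with the same multiset of values differ by a permutation of the domain
(fibrewise bijections from equal fibre cardinalities). -/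
private theorem exists_perm_comp_eq_of_map_eq [DecidableEq α] (f g : ι → α)
    (h : (univ : Finset ι).val.map f = (univ : Finset ι).val.map g) : ∃ π : Equiv.Perm ι, ∀ i, g (π i) = f i := by
  classical
  have hc : ∀ c : α, Fintype.card {i // f i = c} = Fintype.card {i // g i = c} := by
    intro c
    have hcount := congrArg (Multiset.count c) h
    rw [Multiset.count_map, Multiset.count_map] at hcount
    rw [Fintype.card_subtype, Fintype.card_subtype, Finset.card_def, Finset.card_def, Finset.filter_val,
      Finset.filter_val]
    have e1 : (univ : Finset ι).val.filter (fun i => f i = c) = (univ : Finset ι).val.filter fun i => c = f i :=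
      Multiset.filter_congr fun i _ => eq_comm
    have e2 : (univ : Finset ι).val.filter (fun i => g i = c) = (univ : Finset ι).val.filter fun i => c = g i :=
      Multiset.filter_congr fun i _ => eq_comm
    rw [e1, e2, hcount]
  exact ⟨Equiv.ofFiberEquiv (f := f) (g := g) fun c => Fintype.equivOfCardEq (hc c), fun i =>
    Equiv.ofFiberEquiv_map (f := f) (g := g) (fun c => Fintype.equivOfCardEq (hc c)) i⟩

/-- [folklore] the multiset `{z_i} + {−z_i}` is the multiset of values of `i(z) = (z, −z)` on `ι ⊕ ι`. -/
private theorem map_add_map_neg_eq_map_sum [Neg α] (z : ι → α) :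
    (univ : Finset ι).val.map z + (univ : Finset ι).val.map (fun i => -z i) =
      (univ : Finset (ι ⊕ ι)).val.map (Sum.elim z fun i => -z i) := by
  have hval : (univ : Finset (ι ⊕ ι)).val = (univ : Finset ι).val.map Sum.inl + (univ : Finset ι).val.map Sum.inr := by
    rw [← Finset.univ_disjSum_univ]
    rfl
  rw [hval, Multiset.map_add, Multiset.map_map, Multiset.map_map]
  rfl

/-! ## §2 Case C (and D): the `S_{2n}`-orbit of `(x, −x)` determines the signed-permutation orbit of `x` -/

section CaseC

variable [AddCommGroup α] [LinearOrder α]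

/-- **Kottwitz, proof of Lemma 7.4, Case C** («if two elements `x, y ∈ X_*(T) ⊗ ℝ` are such that `i(x), i(y)` are in the
same orbit of `Ω_H` […], then `x, y` are in the same orbit of `Ω`», for `i : Sp_{2n} → GL_{2n}`), in coordinates: if the
multisets `{y_i}_i + {−y_i}_i` and `{x_i}_i + {−x_i}_i` of `2n` elements agree — `i(y) = (y, −y)` is a permutation of
`i(x) = (x, −x)` — then `y` is a SIGNED PERMUTATION of `x`: `y_i = ± x_{π(i)}` for some permutation `π`.  (Kottwitz: the
positive Weyl chamber of `Sp_{2n}` lies in that of `GL_{2n}`; here: compare the multisets of absolute values.)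
[cite: Kottwitz1992, §7, proof of Lemma 7.4 (Case C), p. 397] -/
theorem exists_perm_forall_eq_or_eq_neg (x y : ι → α)
    (h : (univ : Finset ι).val.map y + (univ : Finset ι).val.map (fun i => -y i) =
      (univ : Finset ι).val.map x + (univ : Finset ι).val.map (fun i => -x i)) :
    ∃ π : Equiv.Perm ι, ∀ i, y i = x (π i) ∨ y i = -x (π i) := by
  classical
  -- multisets of absolute values, with doubled multiplicities
  have habs : ∀ z : ι → α, ((univ : Finset ι).val.map z + (univ : Finset ι).val.map (fun i => -z i)).map (fun a => |a|) =
      2 • (univ : Finset ι).val.map (fun i => |z i|) := by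
    intro z
    simp only [Multiset.map_add, Multiset.map_map, Function.comp_def, abs_neg, two_nsmul]
  have h2 : 2 • (univ : Finset ι).val.map (fun i => |y i|) = 2 • (univ : Finset ι).val.map (fun i => |x i|) := by
    rw [← habs y, ← habs x, h]
  -- halve the multiplicities
  have h1 : (univ : Finset ι).val.map (fun i => |y i|) = (univ : Finset ι).val.map (fun i => |x i|) := by
    refine Multiset.ext.2 fun a => ?_
    have hc := congrArg (Multiset.count a) h2
    rw [Multiset.count_nsmul, Multiset.count_nsmul] at hc
    omega
  obtain ⟨π, hπ⟩ := exists_perm_comp_eq_of_map_eq (fun i => |y i|) (fun i => |x i|) h1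
  exact ⟨π, fun i => abs_eq_abs.1 (hπ i).symm⟩

/-- **The same, with `i(x) = (x, −x)` a vector indexed by `ι ⊕ ι` and the Weyl group `S_{2n}` of `GL_{2n}` the permutations
of `ι ⊕ ι`**: if `i(y) = i(x) ∘ τ` for a permutation `τ` of `ι ⊕ ι`, then `y_i = ± x_{π(i)}` for a permutation `π` of `ι`.
[cite: Kottwitz1992, §7, proof of Lemma 7.4 (Case C), p. 397] -/
theorem exists_perm_forall_eq_or_eq_neg_of_perm_sum (x y : ι → α) (τ : Equiv.Perm (ι ⊕ ι))
    (h : ∀ k, Sum.elim y (fun i => -y i) k = Sum.elim x (fun i => -x i) (τ k)) :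
    ∃ π : Equiv.Perm ι, ∀ i, y i = x (π i) ∨ y i = -x (π i) := by
  refine exists_perm_forall_eq_or_eq_neg x y ?_
  have hfun : (Sum.elim y fun i => -y i) = (Sum.elim x fun i => -x i) ∘ τ := funext h
  rw [map_add_map_neg_eq_map_sum y, map_add_map_neg_eq_map_sum x, hfun, ← Multiset.map_map,
    Multiset.map_univ_val_equiv]

/-- **Converse** (the easy direction, `Ω ⊂ Ω_H`: a signed permutation of `x` permutes `(x, −x)`): if `y_i = ± x_{π(i)}` for a
permutation `π`, then `i(y)` is a permutation of `i(x)` — the multisets `{y_i} + {−y_i}` and `{x_i} + {−x_i}` agree.  With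
`exists_perm_forall_eq_or_eq_neg`: the map of orbit spaces `Ω · x ↦ Ω_H · i(x)` is well defined and injective.
[cite: Kottwitz1992, §7, proof of Lemma 7.4 (Case C), p. 397] -/
theorem map_add_map_neg_eq_of_perm (x y : ι → α) (π : Equiv.Perm ι) (h : ∀ i, y i = x (π i) ∨ y i = -x (π i)) :
    (univ : Finset ι).val.map y + (univ : Finset ι).val.map (fun i => -y i) =
      (univ : Finset ι).val.map x + (univ : Finset ι).val.map (fun i => -x i) := by
  classical
  -- the signed permutation, as a permutation of `ι ⊕ ι`: `π` on both copies, then swap the copies where the sign is `−`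
  obtain ⟨c, hc_inl, hc_inr⟩ : ∃ c : ι ⊕ ι → ι ⊕ ι,
      (∀ j, c (Sum.inl j) = if y (π.symm j) = x j then Sum.inl j else Sum.inr j) ∧
      (∀ j, c (Sum.inr j) = if y (π.symm j) = x j then Sum.inr j else Sum.inl j) :=
    ⟨fun k => Sum.elim (fun j => if y (π.symm j) = x j then Sum.inl j else Sum.inr j)
      (fun j => if y (π.symm j) = x j then Sum.inr j else Sum.inl j) k, fun _ => rfl, fun _ => rfl⟩
  have hc : Function.Involutive c := by
    intro k
    rcases k with j | j
    · by_cases hj : y (π.symm j) = x j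
      · rw [hc_inl, if_pos hj, hc_inl, if_pos hj]
      · rw [hc_inl, if_neg hj, hc_inr, if_neg hj]
    · by_cases hj : y (π.symm j) = x j
      · rw [hc_inr, if_pos hj, hc_inr, if_pos hj]
      · rw [hc_inr, if_neg hj, hc_inl, if_neg hj]
  set τ : Equiv.Perm (ι ⊕ ι) := (Equiv.sumCongr π π).trans hc.toPerm with hτ_def
  have hτ : ∀ k, Sum.elim y (fun i => -y i) k = Sum.elim x (fun i => -x i) (τ k) := by
    intro k
    rcases k with i | i
    · have e : τ (Sum.inl i) = c (Sum.inl (π i)) := rfl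
      by_cases hi : y i = x (π i)
      · have hi' : y (π.symm (π i)) = x (π i) := by rwa [Equiv.symm_apply_apply]
        rw [e, hc_inl, if_pos hi']
        exact hi
      · have hi' : ¬ y (π.symm (π i)) = x (π i) := by rwa [Equiv.symm_apply_apply]
        rw [e, hc_inl, if_neg hi']
        exact (h i).resolve_left hi
    · have e : τ (Sum.inr i) = c (Sum.inr (π i)) := rfl
      by_cases hi : y i = x (π i)
      · have hi' : y (π.symm (π i)) = x (π i) := by rwa [Equiv.symm_apply_apply]
        rw [e, hc_inr, if_pos hi']
        show -y i = -x (π i)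
        rw [hi]
      · have hi' : ¬ y (π.symm (π i)) = x (π i) := by rwa [Equiv.symm_apply_apply]
        rw [e, hc_inr, if_neg hi']
        show -y i = x (π i)
        rw [(h i).resolve_left hi, neg_neg]
  have hfun : (Sum.elim y fun i => -y i) = (Sum.elim x fun i => -x i) ∘ τ := funext hτ
  rw [map_add_map_neg_eq_map_sum y, map_add_map_neg_eq_map_sum x, hfun, ← Multiset.map_map,
    Multiset.map_univ_val_equiv]

end CaseC

/-! ## §3 Case A: the diagonal `GL_n → GL_n × GL_n` («Thus Case A is trivial») -/

/-- **Kottwitz, proof of Lemma 7.4, Case A** («our problem decomposes as a product of problems of the form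
`GL_n → GL_n × GL_n` (diagonal map) in Case A […]. Thus Case A is trivial»): if `i(y) = (y, y)` is in the
`S_n × S_n`-orbit of `i(x) = (x, x)`, then `y` is in the `S_n`-orbit of `x`. [cite: Kottwitz1992, §7, proof of Lemma 7.4 (Case A), p. 397] -/
theorem exists_perm_of_perm_prod {κ : Type*} {β : Type*} (x y : κ → β) (π₁ π₂ : Equiv.Perm κ)
    (h : ∀ i, (y i, y i) = (x (π₁ i), x (π₂ i))) : ∃ π : Equiv.Perm κ, ∀ i, y i = x (π i) :=
  ⟨π₁, fun i => (Prod.mk.inj (h i)).1⟩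

/-! ## §4 Similitude groups: `GSp_{2n} → GL_{2n}` (first «modifying `x, y` by an element of the form `j(z)`») -/

section Similitudes

variable [AddCommGroup α] [LinearOrder α] [IsOrderedAddMonoid α]

omit [Fintype ι] in
/-- [folklore] a linearly ordered group has no `2`-torsion: `a + a = b + b → a = b`. -/
private theorem eq_of_add_self_eq_add_self {a b : α} (h : a + a = b + b) : a = b := by
  rcases lt_trichotomy a b with hab | hab | hab
  · exact absurd h (add_lt_add hab hab).ne
  · exact hab
  · exact absurd h (add_lt_add hab hab).ne'

/-- **Kottwitz, proof of Lemma 7.4, for the similitude group** `G = GSp_{2n} ⊂ H = GL_{2n}` («Modifying `x, y` by an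
element of the form `j(z)`, where `z ∈ X_*(𝔾_m) ⊗ ℝ` and `j` is the obvious inclusion of `𝔾_m` in the center of `G`, we
may assume that `x, y ∈ X_1 := X_*(T ∩ G_1) ⊗ ℝ»; then Case C): with the diagonal torus
`diag(t_1, …, t_n, c t_n⁻¹, …, c t_1⁻¹)` of `GSp_{2n}`, a cocharacter is a pair `(x; z)` and `i(x; z) = (x, z − x)`.  If
`i(y; z')` is a permutation of `i(x; z)` — equal multisets `{y_i} + {z' − y_i} = {x_i} + {z − x_i}` — then `z' = z` (compare
sums) and `y_i ∈ {x_{π(i)}, z − x_{π(i)}}` for a permutation `π`, i.e. `(y; z')` and `(x; z)` are in the same orbit of the Weyl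
group of `GSp_{2n}`.  (Valid over `ℤ` as well: instead of subtracting `z/2` we double, `t ↦ 2t − z` carries `i(x; z)` to
`(u, −u)` with `u = 2x − z`, and apply `exists_perm_forall_eq_or_eq_neg`.) [cite: Kottwitz1992, §7, proof of Lemma 7.4, p. 397] -/
theorem exists_perm_forall_eq_or_eq_sub [Nonempty ι] (x y : ι → α) (z z' : α)
    (h : (univ : Finset ι).val.map y + (univ : Finset ι).val.map (fun i => z' - y i) =
      (univ : Finset ι).val.map x + (univ : Finset ι).val.map (fun i => z - x i)) :
    z' = z ∧ ∃ π : Equiv.Perm ι, ∀ i, y i = x (π i) ∨ y i = z - x (π i) := by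
  classical
  -- the central part: compare the sums of the two multisets
  have hsum : ∀ (t : ι → α) (c : α),
      Multiset.sum ((univ : Finset ι).val.map t + (univ : Finset ι).val.map (fun i => c - t i)) =
        (univ : Finset ι).sum (fun _ => c) := by
    intro t c
    rw [Multiset.sum_add]
    change (univ : Finset ι).sum t + (univ : Finset ι).sum (fun i => c - t i) = _
    rw [← Finset.sum_add_distrib]
    exact Finset.sum_congr rfl fun i _ => add_sub_cancel (t i) c
  have hzz : z' = z := by
    have hs := congrArg Multiset.sum h
    rw [hsum y z', hsum x z] at hs
    by_contra hne
    rcases lt_or_gt_of_ne hne with hlt | hlt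
    · exact absurd hs (Finset.sum_lt_sum_of_nonempty Finset.univ_nonempty fun i _ => hlt).ne
    · exact absurd hs (Finset.sum_lt_sum_of_nonempty Finset.univ_nonempty fun i _ => hlt).ne'
  subst hzz
  refine ⟨rfl, ?_⟩
  -- double and recentre: `t ↦ 2t − z'` carries `(x, z' − x)` to `(u, −u)` with `u = 2x − z'`
  have hshift : ∀ t : ι → α, ((univ : Finset ι).val.map t + (univ : Finset ι).val.map (fun i => z' - t i)).map
      (fun a => a + a - z') = (univ : Finset ι).val.map (fun i => t i + t i - z') +
        (univ : Finset ι).val.map (fun i => -(t i + t i - z')) := by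
    intro t
    rw [Multiset.map_add, Multiset.map_map, Multiset.map_map]
    congr 1
    refine Multiset.map_congr rfl fun i _ => ?_
    show z' - t i + (z' - t i) - z' = -(t i + t i - z')
    abel
  have h2 := congrArg (Multiset.map fun a => a + a - z') h
  rw [hshift y, hshift x] at h2
  obtain ⟨π, hπ⟩ := exists_perm_forall_eq_or_eq_neg (fun i => x i + x i - z') (fun i => y i + y i - z') h2
  refine ⟨π, fun i => ?_⟩
  rcases hπ i with hi | hi
  · left
    exact eq_of_add_self_eq_add_self (sub_left_injective hi)
  · right
    apply eq_of_add_self_eq_add_self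
    have hi' : y i + y i = z' + z' - (x (π i) + x (π i)) := by
      have := congrArg (fun a => a + z') hi
      simp only [sub_add_cancel] at this
      rw [this]
      abel
    rw [hi']
    abel

end Similitudes

end Literature.GroupTheory.Coxeter.WeylOrbitInjectivity
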